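import Literature.Geometry.Riemannian.RoundCylinderFourSoliton
import Literature.Geometry.Riemannian.GradientEstimateIntegration
import Literature.Geometry.Lorentzian.VolumeChartIntegral
import Mathlib.Analysis.SpecialFunctions.Gaussian.GaussianIntegral
import Mathlib.MeasureTheory.Function.JacobianOneDim
import Mathlib.MeasureTheory.Integral.IntegralEqImproper
import Mathlib.MeasureTheory.Measure.Lebesgue.VolumeOfBalls
import HarnessLib

/-!
# The round cylinder `S³(2) × ℝ ≅ (ℝ⁴ ∖ 0, 4|y|⁻² δ)`: weighted volume, completeness, topology
(topic `Geometry/Riemannian`)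

Third file of the round-cylinder model. With `hC` the cylinder metric as a Mathlib
`ContMDiffRiemannianMetric` and `dV = riemannianMeasure hC` (the Euclidean-normalised Hausdorff
measure of the length metric, `Volume.lean`):

* `chartGramMatrix_hC`, `sqrt_det_chartGramMatrix_hC` — in the single (inclusion) chart the Gram
  matrix is `e^{2u} · 1` and the density is `√det = 16/|y|⁴`;
* `lintegral_exp_neg_fP_eq` — `∫ e^{-f} dV = ∫_{ℝ⁴} 16 e^{-f} |y|⁻⁴ dy` (chart formula
  `map_extChartAt_restrict_riemannianMeasure`, `{0}` null);
* `integral_radial_Grad`, `integral_Grad_norm` — polar coordinates and the substitution `t = eˣ`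
  turn it into `|S³| · 16 e^{-3/2} ∫ e^{-x²} dx`; **`lintegral_exp_neg_fP`**:
  `∫ e^{-f} dV_{g_c} = 32 π² √π e^{-3/2} = (4π)² Θ(S³×ℝ)` (Cao–Hamilton–Ilmanen 2004, §4, the
  value `.791`) — the bound of crux `EntropyRung.NoncompactShrinkerGap` is attained;
* `ofReal_abs_zP_sub_le_edist` (`|z(x) − z(y)| ≤ d_{g_c}(x,y)`, the height is `1`-Lipschitz) and
  **`isCompact_setOf_edist_le`** — closed `g_c`-balls are compact (completeness in the form used by
  route statements; `NoncompactSpace P4`, `ConnectedSpace P4` are in the soliton file);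
* the shifted potential `fP1 = f − 1`: same Hessian (`soliton_fP1`) but
  `∫ e^{-(f−1)} dV = e · 32π²√π e^{-3/2}` (`lintegral_exp_neg_fP1`, `bound_lt_shifted`) — the
  normalisation `R + |∇f|² = f` is what pins the weighted volume.

Everything is proved; no named facts.

## References

* H.-D. Cao, R. S. Hamilton, T. Ilmanen, arXiv:math/0404165 (2004), §4. [CaoHamiltonIlmanen2004]
* H. Federer, *Geometric Measure Theory*, 1969, §3.2.46 (Riemannian measure in charts). [Federer1969]
-/

noncomputable section

open Bundle Set Function Filter Manifold Metric Module TopologicalSpace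
open scoped Manifold ContDiff Topology RealInnerProductSpace ENNReal NNReal

namespace Literature.Geometry.Riemannian

open Lorentzian Lorentzian.PseudoRiemannianMetric
open _root_.MeasureTheory _root_.MeasureTheory.Measure

namespace RoundCylinderFour

/-! ## Stage 2: the weighted volume `∫ e^{-f} dV_{g_c} = 32 π² √π e^{-3/2}` -/

section Measure


/-- The cylinder metric as a Mathlib `ContMDiffRiemannianMetric` (argument of `riemannianMeasure`). [folklore] -/
abbrev hC : ContMDiffRiemannianMetric 𝓘(ℝ, EuclideanFour) ∞ EuclideanFour
    (TangentSpace 𝓘(ℝ, EuclideanFour) : P4 → Type _) :=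
  cylP.toContMDiffRiemannianMetric isRiemannian_cylP

/-- The Gram matrix of the cylinder metric in its (single, inclusion) chart: `e^{2u(y)} · 1`. [folklore] -/
theorem chartGramMatrix_hC (x₀ : P4) {y : EuclideanFour} (hy : y ∈ (punctured : Set EuclideanFour)) :
    chartGramMatrix hC x₀ y = Real.exp (2 * uE y) • (1 : Matrix (Fin 4) (Fin 4) ℝ) := by
  have hyt : y ∈ (extChartAt 𝓘(ℝ, EuclideanFour) x₀).target := by
    rw [OpensChart.extChartAt_target]; exact hy
  have hsv : ((extChartAt 𝓘(ℝ, EuclideanFour) x₀).symm y : EuclideanFour) = y :=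
    OpensChart.extChartAt_symm_val x₀ hy
  ext i j
  rw [chartGramMatrix_eq_inner_symmL hC x₀ hyt i j, OpensSection.symmL_apply, OpensSection.symmL_apply]
  -- the bundle inner product is `cylP.val`
  change cylP.val ((extChartAt 𝓘(ℝ, EuclideanFour) x₀).symm y) (EuclideanSpace.single i 1)
    (EuclideanSpace.single j 1) = _
  change Real.exp (2 * uE ((extChartAt 𝓘(ℝ, EuclideanFour) x₀).symm y : EuclideanFour)) *
    ⟪(EuclideanSpace.single i (1 : ℝ) : EuclideanFour), EuclideanSpace.single j 1⟫ = _
  rw [hsv, Matrix.smul_apply, Matrix.one_apply, smul_eq_mul]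
  simp [EuclideanSpace.inner_single_left]

/-- The Riemannian density of the cylinder in its chart: `√det (g_c)_{ij}(y) = 16/|y|⁴`. [folklore] -/
theorem sqrt_det_chartGramMatrix_hC (x₀ : P4) {y : EuclideanFour} (hy : y ≠ 0) :
    Real.sqrt (chartGramMatrix hC x₀ y).det = 16 / ‖y‖ ^ 4 := by
  rw [chartGramMatrix_hC x₀ (show y ∈ (punctured : Set EuclideanFour) from hy), Matrix.det_smul,
    Matrix.det_one, mul_one, Fintype.card_fin, exp_two_uE hy]
  have h : (4 / ‖y‖ ^ 2) ^ 4 = (16 / ‖y‖ ^ 4) ^ 2 := by ring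
  rw [h, Real.sqrt_sq (by positivity)]

/-- Support lemma `measurableSet_punctured` of the round-cylinder model `(ℝ⁴∖0, 4|y|⁻²δ)` (see the module docstring). [folklore] -/
theorem measurableSet_punctured : MeasurableSet (punctured : Set EuclideanFour) :=
  isOpen_compl_singleton.measurableSet

/-- Support lemma `measurable_uE` of the round-cylinder model `(ℝ⁴∖0, 4|y|⁻²δ)` (see the module docstring). [folklore] -/
theorem measurable_uE : Measurable uE :=
  measurable_const.sub (measurable_const.mul (Real.measurable_log.comp (measurable_norm.pow_const 2)))

/-- Support lemma `measurable_fE` of the round-cylinder model `(ℝ⁴∖0, 4|y|⁻²δ)` (see the module docstring). [folklore] -/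
theorem measurable_fE : Measurable fE :=
  ((measurable_const.sub measurable_uE).pow_const 2).add measurable_const

/-- **The weighted volume of the cylinder as a Euclidean integral**:
`∫ e^{-f} dV_{g_c} = ∫_{ℝ⁴} 16 e^{-f(y)} |y|⁻⁴ dy` (single chart = inclusion, density `16/|y|⁴`,
`{0}` is Lebesgue-null). [folklore] -/
theorem lintegral_exp_neg_fP_eq :
    ∫⁻ p, ENNReal.ofReal (Real.exp (-fP p)) ∂(riemannianMeasure hC) =
      ∫⁻ y : EuclideanFour, ENNReal.ofReal (Real.exp (-fE y) * (16 / ‖y‖ ^ 4)) := by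
  haveI : Nonempty P4 := ⟨⟨EuclideanSpace.single 0 1, by
    simp [punctured]⟩⟩
  set x₀ : P4 := Classical.arbitrary P4
  -- the chart formula, with `source = univ` and `extChartAt = Subtype.val`
  have hmap := map_extChartAt_restrict_riemannianMeasure hC x₀
  rw [OpensChart.extChartAt_source, Measure.restrict_univ, OpensChart.extChartAt_coe,
    OpensChart.extChartAt_target] at hmap
  have hemb : MeasurableEmbedding (Subtype.val : P4 → EuclideanFour) :=
    MeasurableEmbedding.subtype_coe measurableSet_punctured
  have h1 : ∫⁻ p, ENNReal.ofReal (Real.exp (-fP p)) ∂(riemannianMeasure hC) =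
      ∫⁻ y, ENNReal.ofReal (Real.exp (-fE y)) ∂((riemannianMeasure hC).map Subtype.val) := by
    rw [hemb.lintegral_map]; rfl
  rw [h1, hmap, lintegral_withDensity_eq_lintegral_mul₀
    (aemeasurable_ofReal_sqrt_det_chartGramMatrix hC x₀ |>.mono_measure (by
      rw [OpensChart.extChartAt_target])) (by
      apply Measurable.aemeasurable
      apply Measurable.ennreal_ofReal
      exact (Real.measurable_exp.comp (measurable_fE.neg)))]
  -- on `ℝ⁴ ∖ {0}` the density is `16/|y|⁴`, and `{0}` is null
  have hU : (punctured : Set EuclideanFour) = {(0 : EuclideanFour)}ᶜ := rfl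
  rw [hU, restrict_compl_singleton]
  refine lintegral_congr_ae ?_
  filter_upwards [compl_mem_ae_iff.mpr (measure_singleton (0 : EuclideanFour))] with y hy
  have hy0 : y ≠ 0 := hy
  rw [Pi.mul_apply, sqrt_det_chartGramMatrix_hC x₀ hy0, ← ENNReal.ofReal_mul (by positivity), mul_comm]

/-! ### The radial integral `∫_{ℝ⁴} 16 e^{-f} |y|⁻⁴ dy = 32 π² √π e^{-3/2}` -/

/-- The radial profile of the integrand: `G(t) = 16 e^{-(log² t + 3/2)} t⁻⁴`. [folklore] -/
def Grad (t : ℝ) : ℝ := Real.exp (-((Real.log t) ^ 2 + 3 / 2)) * (16 / t ^ 4)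

/-- Support lemma `integrand_eq_Grad_norm` of the round-cylinder model `(ℝ⁴∖0, 4|y|⁻²δ)` (see the module docstring). [folklore] -/
theorem integrand_eq_Grad_norm {y : EuclideanFour} (hy : y ≠ 0) :
    Real.exp (-fE y) * (16 / ‖y‖ ^ 4) = Grad ‖y‖ := by
  rw [Grad, fE, LE_eq_log hy]

/-- Support lemma `Grad_nonneg` of the round-cylinder model `(ℝ⁴∖0, 4|y|⁻²δ)` (see the module docstring). [folklore] -/
theorem Grad_nonneg (t : ℝ) : 0 ≤ Grad t := by
  unfold Grad
  have : 0 ≤ 16 / t ^ 4 := by positivity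
  positivity

/-- Substitution `t = eˣ`: the pulled-back radial integrand is a Gaussian. [folklore] -/
theorem radial_subst (x : ℝ) :
    |Real.exp x| • (Real.exp x ^ 3 * Grad (Real.exp x)) =
      16 * Real.exp (-(3 : ℝ) / 2) * Real.exp (-1 * x ^ 2) := by
  rw [abs_of_pos (Real.exp_pos x), smul_eq_mul, Grad, Real.log_exp]
  have hx : Real.exp x ≠ 0 := (Real.exp_pos x).ne'
  have h4 : Real.exp x * (Real.exp x ^ 3 * (16 / Real.exp x ^ 4)) = 16 := by
    field_simp
  have hexp : Real.exp (-(x ^ 2 + 3 / 2)) = Real.exp (-(3 : ℝ) / 2) * Real.exp (-1 * x ^ 2) := by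
    rw [← Real.exp_add]; ring_nf
  calc Real.exp x * (Real.exp x ^ 3 * (Real.exp (-(x ^ 2 + 3 / 2)) * (16 / Real.exp x ^ 4)))
      = Real.exp (-(x ^ 2 + 3 / 2)) * (Real.exp x * (Real.exp x ^ 3 * (16 / Real.exp x ^ 4))) := by
        ring
    _ = 16 * Real.exp (-(3 : ℝ) / 2) * Real.exp (-1 * x ^ 2) := by rw [h4, hexp]; ring

/-- `∫₀^∞ t³ G(t) dt = 16 e^{-3/2} √π`, with integrability (substitution `t = eˣ`, Gaussian integral). [folklore] -/
theorem integral_radial_Grad :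
    ∫ t in Ioi (0 : ℝ), t ^ 3 * Grad t = 16 * Real.exp (-(3 : ℝ) / 2) * Real.sqrt Real.pi ∧
      IntegrableOn (fun t : ℝ ↦ t ^ 3 * Grad t) (Ioi 0) := by
  have himage : Real.exp '' univ = Ioi 0 := by rw [image_univ, Real.range_exp]
  have hderiv : ∀ x ∈ (univ : Set ℝ), HasDerivWithinAt Real.exp (Real.exp x) univ x :=
    fun x _ ↦ (Real.hasDerivAt_exp x).hasDerivWithinAt
  have hinj : InjOn Real.exp univ := Real.exp_injective.injOn
  have hfun : (fun x : ℝ ↦ |Real.exp x| • (Real.exp x ^ 3 * Grad (Real.exp x))) =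
      fun x ↦ 16 * Real.exp (-(3 : ℝ) / 2) * Real.exp (-1 * x ^ 2) := funext radial_subst
  refine ⟨?_, ?_⟩
  · rw [← himage, integral_image_eq_integral_abs_deriv_smul MeasurableSet.univ hderiv hinj,
      Measure.restrict_univ, hfun, integral_const_mul, integral_gaussian 1, div_one]
  · rw [← himage, integrableOn_image_iff_integrableOn_abs_deriv_smul MeasurableSet.univ hderiv hinj,
      integrableOn_univ, hfun]
    exact (integrable_exp_neg_mul_sq one_pos).const_mul _

/-- **`∫_{ℝ⁴} G(|y|) dy = 32 π² √π e^{-3/2}`** (polar coordinates, `|B⁴| = π²/2`, `4 · π²/2 = |S³|`). [folklore] -/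
theorem integral_Grad_norm :
    ∫ y : EuclideanFour, Grad ‖y‖ = 32 * Real.pi ^ 2 * Real.sqrt Real.pi * Real.exp (-(3 : ℝ) / 2) ∧
      Integrable (fun y : EuclideanFour ↦ Grad ‖y‖) := by
  obtain ⟨hI, hint⟩ := integral_radial_Grad
  have hdim : finrank ℝ EuclideanFour = 4 := finrank_euclideanSpace_fin
  have hball : (volume : Measure EuclideanFour).real (ball 0 1) = Real.pi ^ 2 / 2 := by
    rw [Measure.real, InnerProductSpace.volume_ball_of_dim_even (k := 2) (by rw [hdim]), hdim]
    rw [ENNReal.toReal_mul, ← ENNReal.ofReal_pow zero_le_one, ENNReal.toReal_ofReal (by positivity),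
      ENNReal.toReal_ofReal (by positivity)]
    norm_num
  refine ⟨?_, ?_⟩
  · have h := integral_fun_norm_addHaar (volume : Measure EuclideanFour) Grad
    rw [h, hdim, hball]
    simp only [smul_eq_mul, nsmul_eq_mul, Nat.cast_ofNat]
    have h3 : ∫ t in Ioi (0 : ℝ), t ^ (4 - 1) * Grad t =
        16 * Real.exp (-(3 : ℝ) / 2) * Real.sqrt Real.pi := by
      simpa using hI
    rw [h3]
    ring
  · refine (integrable_fun_norm_addHaar (volume : Measure EuclideanFour) (f := Grad)).2 ?_
    rw [hdim]
    simpa [smul_eq_mul] using hint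

/-- The Euclidean integral of the cylinder integrand. [folklore] -/
theorem integral_cylinder_integrand :
    ∫ y : EuclideanFour, Real.exp (-fE y) * (16 / ‖y‖ ^ 4) =
        32 * Real.pi ^ 2 * Real.sqrt Real.pi * Real.exp (-(3 : ℝ) / 2) ∧
      Integrable (fun y : EuclideanFour ↦ Real.exp (-fE y) * (16 / ‖y‖ ^ 4)) := by
  obtain ⟨hI, hint⟩ := integral_Grad_norm
  have hae : (fun y : EuclideanFour ↦ Real.exp (-fE y) * (16 / ‖y‖ ^ 4)) =ᵐ[volume]
      fun y ↦ Grad ‖y‖ := by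
    filter_upwards [compl_mem_ae_iff.mpr (measure_singleton (0 : EuclideanFour))] with y hy
    exact integrand_eq_Grad_norm hy
  exact ⟨(integral_congr_ae hae).trans hI, hint.congr hae.symm⟩

/-- **The weighted volume of the round cylinder**: `∫ e^{-f} dV_{g_c} = 32 π² √π e^{-3/2}`
(`= (4π)² Θ(S³×ℝ)`): the bound of the crux `NoncompactShrinkerGap` is ATTAINED. [folklore] -/
theorem lintegral_exp_neg_fP :
    ∫⁻ p, ENNReal.ofReal (Real.exp (-fP p)) ∂(riemannianMeasure hC) =
      ENNReal.ofReal (32 * Real.pi ^ 2 * Real.sqrt Real.pi * Real.exp (-(3 : ℝ) / 2)) := by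
  obtain ⟨hI, hint⟩ := integral_cylinder_integrand
  rw [lintegral_exp_neg_fP_eq, ← hI, ofReal_integral_eq_lintegral_ofReal hint
    (ae_of_all _ fun y ↦ by positivity)]

end Measure

/-! ## Stage 3: completeness, topology, and the shifted potential -/

section Complete

/-- The height `z = 2 log |y|` (twice `L`), the `ℝ`-coordinate of `S³(2) × ℝ`. [folklore] -/
def zP (y : P4) : ℝ := 2 * LE y

/-- Support lemma `contMDiff_zP` of the round-cylinder model `(ℝ⁴∖0, 4|y|⁻²δ)` (see the module docstring). [folklore] -/
theorem contMDiff_zP : ContMDiff 𝓘(ℝ, EuclideanFour) 𝓘(ℝ) ∞ zP := by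
  have h : ContDiffOn ℝ ∞ (fun y ↦ 2 * LE y) {y : EuclideanFour | y ≠ 0} :=
    fun y hy ↦ (contDiffAt_const.mul (contDiffAt_LE hy)).contDiffWithinAt
  exact h.contMDiffOn.comp_contMDiff contMDiff_subtype_val fun y ↦ coe_ne_zero y

/-- Support lemma `mvfderiv_zP` of the round-cylinder model `(ℝ⁴∖0, 4|y|⁻²δ)` (see the module docstring). [folklore] -/
theorem mvfderiv_zP (x : P4) (v : EuclideanFour) :
    mvfderiv 𝓘(ℝ, EuclideanFour) zP x v = 2 * ⟪(x : EuclideanFour), v⟫ / ‖(x : EuclideanFour)‖ ^ 2 := by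
  have hx := coe_ne_zero x
  have hd : HasFDerivAt (fun y ↦ 2 * LE y) ((2 : ℝ) • ((‖(x : EuclideanFour)‖ ^ 2)⁻¹ •
      innerSL ℝ (x : EuclideanFour))) x := (hasFDerivAt_LE hx).const_mul 2
  rw [OpensChart.mvfderiv_eq x zP (fun y ↦ 2 * LE y) (fun _ ↦ rfl) hd.differentiableAt v, hd.fderiv]
  simp only [_root_.smul_apply, innerSL_apply_apply, smul_eq_mul]
  ring

/-- `|dz(v)| ≤ |v|_{g_c}`: the height is `1`-Lipschitz for the cylinder metric. [folklore] -/
theorem abs_mvfderiv_zP_le (x : P4) (v : EuclideanFour) :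
    |mvfderiv 𝓘(ℝ, EuclideanFour) zP x v| ≤ (1 : NNReal) * Real.sqrt (cylP.val x v v) := by
  have hn : 0 < ‖(x : EuclideanFour)‖ := norm_pos x
  rw [mvfderiv_zP, cylP_apply, real_inner_self_eq_norm_sq, NNReal.coe_one, one_mul]
  have hsq : Real.sqrt (4 / ‖(x : EuclideanFour)‖ ^ 2 * ‖v‖ ^ 2) = 2 * ‖v‖ / ‖(x : EuclideanFour)‖ := by
    rw [show 4 / ‖(x : EuclideanFour)‖ ^ 2 * ‖v‖ ^ 2 = (2 * ‖v‖ / ‖(x : EuclideanFour)‖) ^ 2 by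
      rw [div_pow]; ring, Real.sqrt_sq (by positivity)]
  rw [hsq, abs_div, abs_mul, abs_of_pos (by norm_num : (0 : ℝ) < 2), abs_of_pos (pow_pos hn 2),
    div_le_div_iff₀ (pow_pos hn 2) hn]
  have hcs := abs_real_inner_le_norm (x : EuclideanFour) v
  nlinarith [norm_nonneg v, hcs]

/-- **The height difference bounds the distance from below**: `|z(x) − z(y)| ≤ d_{g_c}(x, y)`. [folklore] -/
theorem ofReal_abs_zP_sub_le_edist (x y : P4) :
    ENNReal.ofReal |zP x - zP y| ≤ cylP.edist isRiemannian_cylP x y := by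
  by_cases hfin : cylP.edist isRiemannian_cylP x y = ⊤
  · rw [hfin]; exact le_top
  have hy : y ∈ cylP.ball x ⊤ := by
    rw [PseudoRiemannianMetric.mem_ball, PseudoRiemannianMetric.riemEDist_eq isRiemannian_cylP]
    exact lt_top_iff_ne_top.mpr hfin
  have h := ofReal_abs_sub_le_mul_riemEDist cylP isRiemannian_cylP isOpen_univ
    (contMDiff_zP.of_le (by norm_cast)).contMDiffOn (L := 1)
    (fun z _ v ↦ abs_mvfderiv_zP_le z v) (subset_univ (cylP.ball x ⊤)) hy
  rwa [ENNReal.coe_one, one_mul, PseudoRiemannianMetric.riemEDist_eq isRiemannian_cylP] at h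

/-- The annulus `{a ≤ |y| ≤ b}` is compact. [folklore] -/
theorem isCompact_annulus (a b : ℝ) :
    IsCompact {y : EuclideanFour | a ≤ ‖y‖ ∧ ‖y‖ ≤ b} := by
  have h : {y : EuclideanFour | a ≤ ‖y‖ ∧ ‖y‖ ≤ b} = Metric.closedBall 0 b ∩ {y | a ≤ ‖y‖} := by
    ext y; simp [and_comm]
  rw [h]
  exact (isCompact_closedBall 0 b).inter_right (isClosed_le continuous_const continuous_norm)

/-- **Completeness of the cylinder** in the crux's form: closed `g_c`-balls are compact (they are
closed and contained in a compact annulus, since `|2 log|x| − 2 log|y|| ≤ d(x,y)`). [folklore] -/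
theorem isCompact_setOf_edist_le (x : P4) (r : NNReal) :
    IsCompact {y : P4 | cylP.edist isRiemannian_cylP x y ≤ r} := by
  set a : ℝ := ‖(x : EuclideanFour)‖ * Real.exp (-(r : ℝ) / 2) with ha
  set b : ℝ := ‖(x : EuclideanFour)‖ * Real.exp ((r : ℝ) / 2) with hb
  have ha0 : 0 < a := mul_pos (norm_pos x) (Real.exp_pos _)
  -- the preimage of the annulus is compact in `P4`
  have hK : IsCompact ((Subtype.val : P4 → EuclideanFour) ⁻¹' {y | a ≤ ‖y‖ ∧ ‖y‖ ≤ b}) := by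
    refine Topology.IsEmbedding.subtypeVal.isCompact_iff.mpr ?_
    have himg : (Subtype.val : P4 → EuclideanFour) '' ((Subtype.val : P4 → EuclideanFour) ⁻¹'
        {y | a ≤ ‖y‖ ∧ ‖y‖ ≤ b}) = {y | a ≤ ‖y‖ ∧ ‖y‖ ≤ b} := by
      rw [image_preimage_eq_inter_range, Subtype.range_coe_subtype]
      refine inter_eq_left.mpr fun y hy ↦ ?_
      have : y ≠ 0 := fun h0 ↦ by
        simp only [h0, mem_setOf_eq, norm_zero] at hy; linarith [hy.1]
      exact this
    rw [himg]
    exact isCompact_annulus a b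
  -- the closed ball is closed and contained in it
  have hclosed : IsClosed {y : P4 | cylP.edist isRiemannian_cylP x y ≤ r} :=
    isClosed_le ((PseudoRiemannianMetric.continuous_edist isRiemannian_cylP).comp
      (Continuous.prodMk_right x)) continuous_const
  refine hK.of_isClosed_subset hclosed fun y hy ↦ ?_
  have hz : |zP x - zP y| ≤ r := by
    have h := (ofReal_abs_zP_sub_le_edist x y).trans hy
    rwa [ENNReal.ofReal_le_coe] at h   -- ofReal a ≤ ↑r ↔ a ≤ r
  have hx0 := coe_ne_zero x
  have hy0 := coe_ne_zero y
  rw [zP, zP, LE_eq_log hx0, LE_eq_log hy0] at hz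
  have hz' : |Real.log ‖(x : EuclideanFour)‖ - Real.log ‖(y : EuclideanFour)‖| ≤ r / 2 := by
    rw [← mul_sub, abs_mul, abs_of_pos (by norm_num : (0 : ℝ) < 2)] at hz; linarith
  obtain ⟨h1, h2⟩ := abs_le.mp hz'
  refine ⟨?_, ?_⟩
  · -- a ≤ |y| ⟸ log|x| − r/2 ≤ log|y|
    rw [ha, ← Real.log_le_log_iff ha0 (norm_pos y), Real.log_mul (norm_pos x).ne' (Real.exp_pos _).ne',
      Real.log_exp]
    linarith
  · rw [hb, ← Real.log_le_log_iff (norm_pos y) (mul_pos (norm_pos x) (Real.exp_pos _)),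
      Real.log_mul (norm_pos x).ne' (Real.exp_pos _).ne', Real.log_exp]
    linarith

end Complete



section Shift

/-- The shifted potential `f − 1` (still a soliton potential, but `R + |∇(f−1)|² ≠ f − 1`). [folklore] -/
def fP1 (y : P4) : ℝ := fP y - 1

/-- Support lemma `contMDiff_fP1` of the round-cylinder model `(ℝ⁴∖0, 4|y|⁻²δ)` (see the module docstring). [folklore] -/
theorem contMDiff_fP1 : ContMDiff 𝓘(ℝ, EuclideanFour) 𝓘(ℝ) ∞ fP1 :=
  contMDiff_fP.sub contMDiff_const

/-- Support lemma `mvfderiv_fP1_eq` of the round-cylinder model `(ℝ⁴∖0, 4|y|⁻²δ)` (see the module docstring). [folklore] -/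
theorem mvfderiv_fP1_eq : mvfderiv 𝓘(ℝ, EuclideanFour) fP1 = mvfderiv 𝓘(ℝ, EuclideanFour) fP := by
  funext y
  have hf : MDifferentiableAt 𝓘(ℝ, EuclideanFour) 𝓘(ℝ, ℝ) fP y :=
    contMDiff_fP.mdifferentiableAt (by simp)
  have hc : MDifferentiableAt 𝓘(ℝ, EuclideanFour) 𝓘(ℝ, ℝ) (fun _ : P4 ↦ (1 : ℝ)) y :=
    mdifferentiableAt_const
  change mvfderiv 𝓘(ℝ, EuclideanFour) (fun y ↦ fP y - (fun _ : P4 ↦ (1 : ℝ)) y) y = _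
  rw [mvfderiv_fun_sub hf hc, mvfderiv_const, sub_zero]

/-- Shifting the potential by a constant does not change its Hessian. [folklore] -/
theorem hessian_fP1 (x : P4) : cylP.hessian fP1 x = cylP.hessian fP x := by
  have haux : cylP.hessianAux fP1 = cylP.hessianAux fP := by
    funext X Y z
    simp only [PseudoRiemannianMetric.hessianAux, mvfderiv_fP1_eq]
  unfold PseudoRiemannianMetric.hessian
  rw [haux]

/-- Support lemma `soliton_fP1` of the round-cylinder model `(ℝ⁴∖0, 4|y|⁻²δ)` (see the module docstring). [folklore] -/
theorem soliton_fP1 (x : P4) (X Y : TangentSpace 𝓘(ℝ, EuclideanFour) x) :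
    cylP.ricci x X Y + cylP.hessian fP1 x X Y = (1 / 2 : ℝ) * cylP.val x X Y := by
  rw [hessian_fP1]; exact soliton x X Y

/-- `∫ e^{-(f-1)} dV = e · 32π²√π e^{-3/2}`. [folklore] -/
theorem lintegral_exp_neg_fP1 :
    ∫⁻ p, ENNReal.ofReal (Real.exp (-fP1 p)) ∂(riemannianMeasure hC) =
      ENNReal.ofReal (Real.exp 1 * (32 * Real.pi ^ 2 * Real.sqrt Real.pi * Real.exp (-(3 : ℝ) / 2))) := by
  have h : ∀ p : P4, ENNReal.ofReal (Real.exp (-fP1 p)) =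
      ENNReal.ofReal (Real.exp 1) * ENNReal.ofReal (Real.exp (-fP p)) := by
    intro p
    rw [← ENNReal.ofReal_mul (Real.exp_pos _).le, ← Real.exp_add, fP1]
    ring_nf
  simp_rw [h]
  rw [lintegral_const_mul _ (by
      exact (Real.measurable_exp.comp (contMDiff_fP.continuous.measurable.neg)).ennreal_ofReal),
    lintegral_exp_neg_fP, ← ENNReal.ofReal_mul (Real.exp_pos _).le]

/-- The shifted integral exceeds the crux bound (`e > 1`). [folklore] -/
theorem bound_lt_shifted :
    32 * Real.pi ^ 2 * Real.sqrt Real.pi * Real.exp (-(3 : ℝ) / 2) <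
      Real.exp 1 * (32 * Real.pi ^ 2 * Real.sqrt Real.pi * Real.exp (-(3 : ℝ) / 2)) := by
  have hpos : 0 < 32 * Real.pi ^ 2 * Real.sqrt Real.pi * Real.exp (-(3 : ℝ) / 2) := by positivity
  have he : (1 : ℝ) < Real.exp 1 := Real.one_lt_exp_iff.mpr one_pos
  nlinarith

end Shift

end RoundCylinderFour

end Literature.Geometry.Riemannian

end
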